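import Summits.Parity.GeneralizedHardyLittlewood.Theorems.GreenTaoLevelTwoMNTwoCosKernel
import Summits.Parity.GeneralizedHardyLittlewood.Theorems.GreenTaoLevelTwoMNTwoGridSmoothing

/-!
# Route `GreenTaoLevelTwo`, crux `MNTwo` (stmt-Parity-21276), line `birth`, stub `stub_mnVertical`:
# Fourier expansion of Bohr-gauge Lipschitz cutoffs (AIF Lemma 37 in the form used by Lemma 24)

The restricted Fourier hypothesis of `…MNTwoLemma24PolySmall.lemma24_poly_small`, PROVED (B. Green,
T. Tao, *Quadratic uniformity of the Möbius function*, Ann. Inst. Fourier 58 (2008) =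
arXiv:math/0606087, App. A Lemma 37 "Fourier approximation of Lipschitz functions", applied to the
Bohr-gauge cutoffs of §§9–10): for `N ≥ 1`, `0 < ρ ≤ 1/4`, frequencies `α : Fin k → ℝ`, a centre `n₀`
and a weight `ψ : ℤ → [0,1]` supported in `{ν(n - n₀) < ρ}` and `1`-Lipschitz for
`ν(h) = maxᵢ ‖hαᵢ‖_{ℝ/ℤ} + |h|/N`, and every `0 < δ ≤ 1`, there are `J ≤ Cf δ^{-D}` characters
`e(β_j n)` and coefficients of norm `≤ 1` with `|ψ(n) - ∑ c_j e(β_j n)| ≤ δ` on `{ν(n-n₀) < 3ρ}`;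
`D = 5(k+1)`, `Cf = (3(3k+4)⁵)^{k+1}`.
Proof: McShane lift of `ψ` to `G(x) = max(0, max_{|m-n₀|<ρN} (ψ(m) - 2∑ᵢ‖xᵢ - mα'ᵢ‖))` on `ℝ^{k+1}`
(`α' = (1/(2N), α)`), which is `[0,1]`-valued, `2`-Lipschitz for `∑ᵢ‖·‖_{ℝ/ℤ}` and agrees with `ψ`
at `nα'` on the window (since `ν(h) ≤ 2∑ᵢ‖hα'ᵢ‖` for `|h| ≤ N`); then
`…MNTwoGridSmoothing.grid_smoothing` with the cosine-power kernel of `…MNTwoCosKernel`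
(`R = m⁵`, `M = R+1`, `s = 1/m`, `m = ⌈9(k+1)/(4δ)⌉`), and re-indexing `[0,2R]^{k+1} ≃ range J`.
Def-free.

* `bohr_le_two_sum` — `ν(h) ≤ 2 ∑ᵢ ‖h α'ᵢ‖` for `|h| ≤ N`;
* `cosKernel_grid_sum`, `cosKernel_eq_sum` — the kernel hypotheses of `grid_smoothing`;
* `hfour_small` — the statement above (hypothesis `hfour` of `lemma24_poly_small`, every `k`).

References: [GreenTao2008QuadraticMobius] arXiv:math/0606087 App. A (Lemma 37), §10.
-/

noncomputable section

open Finset Real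
open scoped FourierTransform

namespace Summit.Parity.GeneralizedHardyLittlewood.GreenTaoLevelTwoMNTwoBohrFourier

open Summit.Parity.GeneralizedHardyLittlewood.GreenTaoLevelTwoMNTwoCosKernel
open Summit.Parity.GeneralizedHardyLittlewood.GreenTaoLevelTwoMNTwoGridSmoothing

/-! ### §1 The Bohr gauge is dominated by the torus distance -/

/-- For `|h| ≤ N` (`N ≥ 1`): `maxᵢ‖hαᵢ‖ + |h|/N ≤ 2 ∑_{i ≤ k} ‖h α'ᵢ‖` with `α' = (1/(2N), α)`.
[folklore] -/
theorem bohr_le_two_sum (k : ℕ) {N : ℕ} (hN : 0 < N) (α : Fin k → ℝ) (h : ℝ)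
    (hh : |h| ≤ N) :
    (⨆ i : Fin k, ‖((h * α i : ℝ) : AddCircle (1 : ℝ))‖) + |h| / N ≤
      2 * ∑ i : Fin (k + 1),
        ‖((h * (Fin.cons (1 / (2 * (N : ℝ))) α : Fin (k + 1) → ℝ) i : ℝ) : AddCircle (1 : ℝ))‖ := by
  rw [Fin.sum_univ_succ]
  simp only [Fin.cons_zero, Fin.cons_succ]
  have hNr : (0 : ℝ) < N := by exact_mod_cast hN
  have h0 : ‖((h * (1 / (2 * (N : ℝ))) : ℝ) : AddCircle (1 : ℝ))‖ = |h| / (2 * N) := by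
    rw [(AddCircle.norm_coe_eq_abs_iff (1 : ℝ) one_ne_zero).mpr]
    · rw [abs_mul, abs_of_pos (by positivity : (0 : ℝ) < 1 / (2 * N))]; ring
    · rw [abs_mul, abs_of_pos (by positivity : (0 : ℝ) < 1 / (2 * N)), abs_one]
      rw [mul_one_div, div_le_div_iff₀ (by positivity) (by norm_num)]
      linarith
  rw [h0]
  have hsum0 : 0 ≤ ∑ i : Fin k, ‖((h * α i : ℝ) : AddCircle (1 : ℝ))‖ :=
    Finset.sum_nonneg fun i _ => norm_nonneg _
  have hsup : (⨆ i : Fin k, ‖((h * α i : ℝ) : AddCircle (1 : ℝ))‖) ≤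
      ∑ i : Fin k, ‖((h * α i : ℝ) : AddCircle (1 : ℝ))‖ :=
    Real.iSup_le (fun i => Finset.single_le_sum (f := fun i => ‖((h * α i : ℝ) : AddCircle (1 : ℝ))‖)
      (fun j _ => norm_nonneg _) (Finset.mem_univ i)) hsum0
  have e : |h| / N = 2 * (|h| / (2 * N)) := by field_simp
  rw [e]
  linarith

/-! ### §2 The cosine-power kernel satisfies the hypotheses of `grid_smoothing` -/

/-- `∑_{u<M} K_R(x - u/M) = M` for `R < M`. [folklore] -/
theorem cosKernel_grid_sum {R M : ℕ} (hRM : R < M) (x : ℝ) :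
    ∑ u ∈ range M, (4 : ℝ) ^ R / (Nat.centralBinom R : ℝ) * Real.cos (π * (x - u / M)) ^ (2 * R)
      = M := by
  have h := sum_two_cos_pow_grid (R := R) hRM x
  have e : ∀ u : ℕ, (4 : ℝ) ^ R / (Nat.centralBinom R : ℝ) * Real.cos (π * (x - u / M)) ^ (2 * R)
      = (1 / (Nat.centralBinom R : ℝ)) * (2 * Real.cos (π * (x - u / M))) ^ (2 * R) := by
    intro u
    rw [mul_pow, pow_mul (2 : ℝ) 2 R]; norm_num; ring
  simp_rw [e, ← Finset.mul_sum, h, Nat.centralBinom]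
  have hc : ((2 * R).choose R : ℝ) ≠ 0 := by
    have := Nat.centralBinom_pos R
    rw [Nat.centralBinom] at this
    exact_mod_cast this.ne'
  field_simp

/-- `K_R(t) = ∑_{j ≤ 2R} (binom(2R,j)/binom(2R,R)) e((j-R)t)`. [folklore] -/
theorem cosKernel_eq_sum (R : ℕ) (t : ℝ) :
    (((4 : ℝ) ^ R / (Nat.centralBinom R : ℝ) * Real.cos (π * t) ^ (2 * R) : ℝ) : ℂ) =
      ∑ j ∈ range (2 * R + 1), ((((2 * R).choose j : ℝ) / (Nat.centralBinom R : ℝ) : ℝ) : ℂ) *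
        Complex.exp (((2 * π * ((j - R : ℝ) * t) : ℝ) : ℂ) * Complex.I) := by
  have e : (4 : ℝ) ^ R / (Nat.centralBinom R : ℝ) * Real.cos (π * t) ^ (2 * R) =
      (2 * Real.cos (π * t)) ^ (2 * R) / (Nat.centralBinom R : ℝ) := by
    rw [mul_pow, pow_mul (2 : ℝ) 2 R]; norm_num; ring
  rw [e, Complex.ofReal_div, two_cos_pow_eq_sum, Finset.sum_div]
  refine Finset.sum_congr rfl fun j _ => ?_
  push_cast
  ring

/-! ### §3 The McShane lift -/

/-- **McShane lift.**  For a finite non-empty set `S` of integers, frequencies `α' : Fin d → ℝ` and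
values `ψ : ℤ → ℝ` with `ψ ≤ 1`, the function `G(x) = max(0, max_{m ∈ S} (ψ m - 2∑ᵢ‖xᵢ - mα'ᵢ‖))` is
`[0,1]`-valued and `2`-Lipschitz for `∑ᵢ ‖·‖_{ℝ/ℤ}`. [folklore] -/
theorem mcshane_lift {d : ℕ} (S : Finset ℤ) (hS : S.Nonempty) (α' : Fin d → ℝ) (ψ : ℤ → ℝ)
    (hψ1 : ∀ n, ψ n ≤ 1) :
    (∀ x : Fin d → ℝ, 0 ≤ max 0 (S.sup' hS fun m => ψ m -
        2 * ∑ i, ‖((x i - m * α' i : ℝ) : AddCircle (1 : ℝ))‖)) ∧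
    (∀ x : Fin d → ℝ, max 0 (S.sup' hS fun m => ψ m -
        2 * ∑ i, ‖((x i - m * α' i : ℝ) : AddCircle (1 : ℝ))‖) ≤ 1) ∧
    (∀ x y : Fin d → ℝ, max 0 (S.sup' hS fun m => ψ m -
        2 * ∑ i, ‖((x i - m * α' i : ℝ) : AddCircle (1 : ℝ))‖) ≤
      max 0 (S.sup' hS fun m => ψ m - 2 * ∑ i, ‖((y i - m * α' i : ℝ) : AddCircle (1 : ℝ))‖) +
        2 * ∑ i, ‖((x i - y i : ℝ) : AddCircle (1 : ℝ))‖) := by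
  refine ⟨fun x => le_max_left _ _, fun x => ?_, fun x y => ?_⟩
  · refine max_le zero_le_one (Finset.sup'_le _ _ fun m _ => ?_)
    have : 0 ≤ ∑ i, ‖((x i - m * α' i : ℝ) : AddCircle (1 : ℝ))‖ :=
      Finset.sum_nonneg fun i _ => norm_nonneg _
    linarith [hψ1 m]
  · have hy0 : 0 ≤ max 0 (S.sup' hS fun m => ψ m -
        2 * ∑ i, ‖((y i - m * α' i : ℝ) : AddCircle (1 : ℝ))‖) := le_max_left _ _
    have hxy0 : 0 ≤ ∑ i, ‖((x i - y i : ℝ) : AddCircle (1 : ℝ))‖ :=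
      Finset.sum_nonneg fun i _ => norm_nonneg _
    refine max_le (by linarith) (Finset.sup'_le _ _ fun m hm => ?_)
    have htri : ∑ i, ‖((y i - m * α' i : ℝ) : AddCircle (1 : ℝ))‖ ≤
        ∑ i, ‖((x i - y i : ℝ) : AddCircle (1 : ℝ))‖ +
          ∑ i, ‖((x i - m * α' i : ℝ) : AddCircle (1 : ℝ))‖ := by
      rw [← Finset.sum_add_distrib]
      refine Finset.sum_le_sum fun i _ => ?_
      have e : (((y i - m * α' i : ℝ)) : AddCircle (1 : ℝ)) =
          (((y i - x i : ℝ)) : AddCircle (1 : ℝ)) + (((x i - m * α' i : ℝ)) : AddCircle (1 : ℝ)) := by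
        rw [← AddCircle.coe_add]; congr 1; ring
      rw [e, norm_coe_sub_comm (x i) (y i)]
      exact norm_add_le _ _
    have hle : ψ m - 2 * ∑ i, ‖((y i - m * α' i : ℝ) : AddCircle (1 : ℝ))‖ ≤
        max 0 (S.sup' hS fun m => ψ m - 2 * ∑ i, ‖((y i - m * α' i : ℝ) : AddCircle (1 : ℝ))‖) :=
      le_trans (Finset.le_sup' (fun m => ψ m -
        2 * ∑ i, ‖((y i - m * α' i : ℝ) : AddCircle (1 : ℝ))‖) hm) (le_max_right _ _)
    linarith

/-! ### §4 AIF Lemma 37 for Bohr-gauge cutoffs -/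

/-- **Fourier expansion of Bohr-gauge Lipschitz cutoffs** (the hypothesis `hfour` of
`…MNTwoLemma24PolySmall.lemma24_poly_small`, every `k`).  See the module docstring.
[cite: GreenTao2008QuadraticMobius, App. A Lemma 37] -/
theorem hfour_small (k : ℕ) :
    ∃ (D : ℕ) (Cf : ℝ), 1 ≤ Cf ∧ ∀ (N : ℕ), 0 < N → ∀ (α : Fin k → ℝ) (n₀ : ℤ) (ρ : ℝ),
      0 < ρ → 4 * ρ ≤ 1 →
      ∀ (ψ : ℤ → ℝ), (∀ n, 0 ≤ ψ n) → (∀ n, ψ n ≤ 1) →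
        (∀ n, ψ n ≠ 0 →
          (⨆ i : Fin k, ‖((((n - n₀ : ℤ) : ℝ) * α i : ℝ) : AddCircle (1 : ℝ))‖) +
            |((n - n₀ : ℤ) : ℝ)| / N < ρ) →
        (∀ n n' : ℤ, |ψ n - ψ n'| ≤
          (⨆ i : Fin k, ‖((((n - n' : ℤ) : ℝ) * α i : ℝ) : AddCircle (1 : ℝ))‖) +
            |((n - n' : ℤ) : ℝ)| / N) →
      ∀ δ : ℝ, 0 < δ → δ ≤ 1 → ∃ J : ℕ, 1 ≤ J ∧ (J : ℝ) ≤ Cf / δ ^ D ∧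
        ∃ (c : ℕ → ℂ) (β : ℕ → ℝ), (∀ j, ‖c j‖ ≤ 1) ∧ ∀ n : ℤ,
          (⨆ i : Fin k, ‖((((n - n₀ : ℤ) : ℝ) * α i : ℝ) : AddCircle (1 : ℝ))‖) +
              |((n - n₀ : ℤ) : ℝ)| / N < 3 * ρ →
            ‖((ψ n : ℝ) : ℂ) - ∑ j ∈ range J, c j * (𝐞 (β j * (n : ℝ)) : ℂ)‖ ≤ δ := by
  classical
  refine ⟨5 * (k + 1), (3 * (3 * (k : ℝ) + 4) ^ 5) ^ (k + 1), ?_, ?_⟩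
  · refine one_le_pow₀ ?_
    have : (1 : ℝ) ≤ (3 * (k : ℝ) + 4) ^ 5 := one_le_pow₀ (by linarith [Nat.cast_nonneg (α := ℝ) k])
    linarith
  intro N hN α n₀ ρ hρ hρ4 ψ hψ0 hψ1 hsupp hlip δ hδ hδ1
  have hNr : (0 : ℝ) < N := by exact_mod_cast hN
  -- parameters
  set m : ℕ := ⌈9 * ((k : ℝ) + 1) / (4 * δ)⌉₊ with hm
  have hm1 : 1 ≤ m := by
    rw [hm, Nat.one_le_ceil_iff]; positivity
  have hmr : (1 : ℝ) ≤ m := by exact_mod_cast hm1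
  have hmge : 9 * ((k : ℝ) + 1) / (4 * δ) ≤ m := by rw [hm]; exact Nat.le_ceil _
  have hmle : (m : ℝ) ≤ (3 * k + 4) / δ := by
    have h1 : (m : ℝ) < 9 * ((k : ℝ) + 1) / (4 * δ) + 1 := by rw [hm]; exact Nat.ceil_lt_add_one (by positivity)
    have h2 : 9 * ((k : ℝ) + 1) / (4 * δ) + 1 ≤ (3 * k + 4) / δ := by
      rw [div_add_one (by positivity), div_le_div_iff₀ (by positivity) hδ]
      have hk0 : (0 : ℝ) ≤ k := Nat.cast_nonneg k
      nlinarith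
    linarith
  set R : ℕ := m ^ 5 with hR
  have hR1 : 1 ≤ R := Nat.one_le_pow _ _ hm1
  set M : ℕ := R + 1 with hM
  have hRM : R < M := Nat.lt_succ_self R
  have hM0 : 0 < M := Nat.succ_pos R
  -- the frequencies `α' = (1/(2N), α)` and the set `S`
  set α' : Fin (k + 1) → ℝ := Fin.cons (1 / (2 * (N : ℝ))) α with hα'
  set S : Finset ℤ := (Finset.Icc (n₀ - N) (n₀ + N)).filter
    (fun m' => |((m' - n₀ : ℤ) : ℝ)| < ρ * N) with hSdef
  have hn₀S : n₀ ∈ S := by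
    rw [hSdef, Finset.mem_filter]; refine ⟨by simp, ?_⟩; simp; positivity
  have hSne : S.Nonempty := ⟨n₀, hn₀S⟩
  have hmemS : ∀ m' ∈ S, |((m' : ℝ) - n₀)| < ρ * N := by
    intro m' hm'; rw [hSdef, Finset.mem_filter] at hm'; have := hm'.2; push_cast at this; exact this
  have hsuppS : ∀ n, ψ n ≠ 0 → n ∈ S := by
    intro n hn
    have h1 := hsupp n hn
    have hsup0 : 0 ≤ ⨆ i : Fin k, ‖((((n - n₀ : ℤ) : ℝ) * α i : ℝ) : AddCircle (1 : ℝ))‖ :=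
      Real.iSup_nonneg fun i => norm_nonneg _
    have h2 : |((n - n₀ : ℤ) : ℝ)| / N < ρ := by linarith
    rw [div_lt_iff₀ hNr] at h2
    have h3 : |((n - n₀ : ℤ) : ℝ)| ≤ N := by nlinarith
    push_cast at h3
    rw [abs_le] at h3
    rw [hSdef, Finset.mem_filter, Finset.mem_Icc]
    refine ⟨⟨?_, ?_⟩, h2⟩
    · have : ((n₀ : ℝ) - N : ℝ) ≤ n := by linarith
      exact_mod_cast this
    · have : (n : ℝ) ≤ (n₀ : ℝ) + N := by linarith
      exact_mod_cast this
  -- the lift `G`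
  set G : (Fin (k + 1) → ℝ) → ℝ := fun x => max 0 (S.sup' hSne fun m' => ψ m' -
    2 * ∑ i, ‖((x i - m' * α' i : ℝ) : AddCircle (1 : ℝ))‖) with hGdef
  have hG0 : ∀ x, 0 ≤ G x := fun x => by
    simp only [hGdef]; exact (mcshane_lift S hSne α' ψ hψ1).1 x
  have hG1 : ∀ x, G x ≤ 1 := fun x => by
    simp only [hGdef]; exact (mcshane_lift S hSne α' ψ hψ1).2.1 x
  have hGL : ∀ x y, G x ≤ G y + 2 * ∑ i, ‖((x i - y i : ℝ) : AddCircle (1 : ℝ))‖ := fun x y => by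
    simp only [hGdef]; exact (mcshane_lift S hSne α' ψ hψ1).2.2 x y
  -- `G(n α') = ψ n` on the window
  have hGθ : ∀ n : ℤ,
      (⨆ i : Fin k, ‖((((n - n₀ : ℤ) : ℝ) * α i : ℝ) : AddCircle (1 : ℝ))‖) +
          |((n - n₀ : ℤ) : ℝ)| / N < 3 * ρ → G (fun i => (n : ℝ) * α' i) = ψ n := by
    intro n hn
    simp only [hGdef]
    have hsup0 : 0 ≤ ⨆ i : Fin k, ‖((((n - n₀ : ℤ) : ℝ) * α i : ℝ) : AddCircle (1 : ℝ))‖ :=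
      Real.iSup_nonneg fun i => norm_nonneg _
    have hn3 : |((n : ℝ) - n₀)| < 3 * ρ * N := by
      have h2 : |((n - n₀ : ℤ) : ℝ)| / N < 3 * ρ := by linarith
      rw [div_lt_iff₀ hNr] at h2; push_cast at h2; exact h2
    apply le_antisymm
    · refine max_le (hψ0 n) (Finset.sup'_le _ _ fun m' hm' => ?_)
      have hm'n : |((m' : ℝ) - n)| ≤ N := by
        have h1 := hmemS m' hm'
        rw [abs_lt] at h1 hn3
        rw [abs_le]; constructor <;> nlinarith
      have hνle := bohr_le_two_sum k hN α ((m' : ℝ) - n) hm'n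
      have hlip' := hlip m' n
      have habs : ψ m' - ψ n ≤ |ψ m' - ψ n| := le_abs_self _
      have ecast : (((m' - n : ℤ) : ℝ)) = (m' : ℝ) - n := by push_cast; ring
      rw [ecast] at hlip'
      have esum : ∑ i : Fin (k + 1),
          ‖(((((m' : ℝ) - n) * (Fin.cons (1 / (2 * (N : ℝ))) α : Fin (k + 1) → ℝ) i : ℝ)) :
            AddCircle (1 : ℝ))‖ =
          ∑ i : Fin (k + 1), ‖((((n : ℝ) * α' i - m' * α' i : ℝ)) : AddCircle (1 : ℝ))‖ := by
        refine Finset.sum_congr rfl fun i _ => ?_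
        rw [norm_coe_sub_comm ((n : ℝ) * α' i), hα']; congr 2; ring
      rw [esum] at hνle
      linarith
    · by_cases hψn : ψ n = 0
      · rw [hψn]; exact le_max_left _ _
      · have hnS := hsuppS n hψn
        refine le_trans ?_ (le_max_right _ _)
        refine le_trans ?_ (Finset.le_sup' (fun m' => ψ m' -
          2 * ∑ i, ‖((((n : ℝ) * α' i - m' * α' i : ℝ)) : AddCircle (1 : ℝ))‖) hnS)
        simp
  -- the kernel
  set s : ℝ := 1 / m with hs
  have hs0 : 0 < s := by positivity
  set ε : ℝ := s + 1 / (8 * s ^ 4 * R) with hε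
  set K : ℝ → ℝ := fun t => (4 : ℝ) ^ R / (Nat.centralBinom R : ℝ) * Real.cos (π * t) ^ (2 * R)
    with hK
  set a : ℕ → ℝ := fun j => ((2 * R).choose j : ℝ) / (Nat.centralBinom R : ℝ) with ha
  have hK0 : ∀ t, 0 ≤ K t := fun t => by simp only [hK]; rw [pow_mul]; positivity
  have hK1 : ∀ x : ℝ, ∑ u ∈ range M, K (x - u / M) = M := fun x => by
    simp only [hK]; exact cosKernel_grid_sum hRM x
  have hMr : (0 : ℝ) < M := by exact_mod_cast hM0
  have hK2 : ∀ x : ℝ,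
      ∑ u ∈ range M, ‖((x - u / M : ℝ) : AddCircle (1 : ℝ))‖ * K (x - u / M) ≤ ε * M := by
    intro x
    have h := sum_norm_mul_cosKernel_grid_le hR1 hRM hs0 x
    rw [div_le_iff₀ hMr] at h
    simp only [hK, hε]
    exact h
  have hK3 : ∀ t : ℝ, ((K t : ℝ) : ℂ) = ∑ j ∈ range (2 * R + 1), ((a j : ℝ) : ℂ) *
      Complex.exp (((2 * π * ((j - R : ℝ) * t) : ℝ) : ℂ) * Complex.I) := fun t => by
    simp only [hK, ha]; exact cosKernel_eq_sum R t
  have ha1 : ∀ j, |a j| ≤ 1 := by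
    intro j
    simp only [ha]
    have hcb : (0 : ℝ) < (Nat.centralBinom R : ℝ) := by exact_mod_cast Nat.centralBinom_pos R
    rw [abs_of_nonneg (by positivity), div_le_one hcb]
    exact_mod_cast Nat.choose_le_centralBinom j R
  -- smoothing
  obtain ⟨c, hc1, hcG⟩ := grid_smoothing (R := R) hM0 K a hK0 hK1 hK2 hK3 ha1 G hG0 hG1
    (L := 2) (by norm_num) hGL
  -- `2(k+1)ε ≤ δ`
  have hεδ : 2 * ((k + 1 : ℕ) : ℝ) * ε ≤ δ := by
    have hε' : ε = 9 / (8 * m) := by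
      simp only [hε, hs, hR]; push_cast
      have hm0 : (m : ℝ) ≠ 0 := by positivity
      field_simp
      ring
    rw [hε']
    have h1 : 9 * ((k : ℝ) + 1) ≤ m * (4 * δ) := by
      have := hmge; rwa [div_le_iff₀ (by positivity)] at this
    push_cast
    rw [show 2 * ((k : ℝ) + 1) * (9 / (8 * m)) = 9 * ((k : ℝ) + 1) / (4 * m) by
      field_simp; ring]
    rw [div_le_iff₀ (by positivity)]
    linarith
  -- `J` and the re-indexing
  set J : ℕ := (2 * R + 1) ^ (k + 1) with hJ
  have E : (Fin (k + 1) → Fin (2 * R + 1)) ≃ Fin J :=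
    finPiFinEquiv.trans (finCongr (Fin.prod_const (k + 1) (2 * R + 1)))
  refine ⟨J, Nat.one_le_pow _ _ (by omega), ?_,
    fun j => if h : j < J then c (E.symm ⟨j, h⟩) else 0,
    fun j => if h : j < J then ∑ i, ((((E.symm ⟨j, h⟩ i : ℕ) : ℝ) - R) * α' i) else 0,
    ?_, ?_⟩
  · -- `J ≤ Cf / δ^D`
    have hm5 : (m : ℝ) ^ 5 ≤ ((3 * k + 4) / δ) ^ 5 := pow_le_pow_left₀ (by positivity) hmle 5
    have hm51 : (1 : ℝ) ≤ (m : ℝ) ^ 5 := one_le_pow₀ hmr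
    have hδ5 : 0 < δ ^ 5 := by positivity
    have hbase : ((2 * R + 1 : ℕ) : ℝ) ≤ 3 * (3 * (k : ℝ) + 4) ^ 5 / δ ^ 5 := by
      rw [div_pow] at hm5
      push_cast [hR]
      rw [le_div_iff₀ hδ5]
      rw [le_div_iff₀ hδ5] at hm5
      nlinarith
    rw [hJ, Nat.cast_pow, pow_mul, ← div_pow]
    exact pow_le_pow_left₀ (by positivity) hbase _
  · -- `‖c j‖ ≤ 1`
    intro j
    by_cases h : j < J
    · simp only [h, dif_pos]; exact hc1 _
    · simp only [h, dif_neg, not_false_eq_true, norm_zero]; exact zero_le_one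
  · intro n hn
    rw [← hGθ n hn]
    have hsum : ∑ j ∈ range J, (if h : j < J then c (E.symm ⟨j, h⟩) else 0) *
        (𝐞 ((if h : j < J then ∑ i, ((((E.symm ⟨j, h⟩ i : ℕ) : ℝ) - R) * α' i) else 0) *
          (n : ℝ)) : ℂ) =
        ∑ r : Fin (k + 1) → Fin (2 * R + 1), c r *
          Complex.exp (((2 * π * (∑ i, (((r i : ℕ) : ℝ) - R) * ((n : ℝ) * α' i)) : ℝ) : ℂ) *
            Complex.I) := by
      rw [Finset.sum_range, ← Equiv.sum_comp E]
      refine Fintype.sum_congr _ _ fun r => ?_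
      have hlt : ((E r : Fin J) : ℕ) < J := (E r).2
      simp only [hlt, dif_pos, Fin.eta, Equiv.symm_apply_apply]
      congr 1
      rw [Real.fourierChar_apply]
      have e : (∑ i, ((((r i : ℕ) : ℝ) - R) * α' i)) * (n : ℝ) =
          ∑ i, (((r i : ℕ) : ℝ) - R) * ((n : ℝ) * α' i) := by
        rw [Finset.sum_mul]; exact Finset.sum_congr rfl fun i _ => by ring
      rw [e]
    rw [hsum]
    exact (hcG _).trans hεδ

end Summit.Parity.GeneralizedHardyLittlewood.GreenTaoLevelTwoMNTwoBohrFourier
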